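import Literature.NumberTheory.Automorphic.ArchimedeanCharacterTwist
import Literature.NumberTheory.Automorphic.IdeleNormDetGL
import Literature.NumberTheory.Automorphic.AutomorphicFormsSpan
import HarnessLib

/-!
# Twisting automorphic representations of `GL_n(𝔸_K)` by `|det|_𝔸^s`, `s ∈ ℂ`, in the
Borel–Jacquet model

Topic `NumberTheory/Automorphic`. Companion of `AutomorphicTwistBJ`, which constructs the twist
`π ⊗ (χ ∘ det)` of a Borel–Jacquet datum `π = W / W'` (`AutomorphicRepData (AutomorphyDatum.gl n K hcpt)`)
for Hecke characters `χ` **of finite order** (trivial on `exp 𝔤`). Here `χ = ‖·‖^s` is a norm power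
(`χ(x) = ‖x‖_𝔸^s`, `s ∈ ℂ` arbitrary; `exists_heckeCharacter_ideleNorm_cpow`), the character by which a
cuspidal representation with arbitrary central character is normalised to be trivial on the split
component `A_G` (Borel–Jacquet 1979, 5.7: "`π = π₀ ⊗ |det|^s` with `π₀` unitary"; the step "We may
assume `π, π'` unitary" of Arthur–Clozel 1989, Ch. 3, proof of Thm. 3.1). All proved, no definitions
(the twisted datum is packaged existentially):

* `IsAutomorphicForm.mulChar_detTwist_of_cpow` — **`|det|^s · φ` is an automorphic form if `φ` is**
  (`n ≥ 1`): left invariance (product formula), the same level (`|det|_𝔸 = 1` on levels,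
  `apply_det_eq_one_of_mem_finiteLevelsGL`), smoothness and `Z(𝔤)`-finiteness
  (`ArchimedeanCharacterTwist` with `|det (exp X, 1)|_𝔸^s = e^{s λ(X)}`,
  `exists_linearMap_ideleNorm_det_ofInfinite_expGL`), `K_∞`-finiteness, and moderate growth
  (`exists_ideleNorm_det_rpow_le_height`).
* `IsStableSubmodule.map_mulChar_detTwist_of_cpow`, `exists_automorphicRepData_map_mulChar_detTwist`
  (the twisted datum `W ↦ |det|^s W`, `W' ↦ |det|^s W'`), `map_mulChar_detTwist_le_cuspFormsGL_of_cpow`,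
  `exists_cuspidalAutomorphicRepData_map_mulChar_detTwist`.
* `AutomorphicRepData.HasSatakeParamAt.of_map_mulChar_detTwist_of_cpow` —
  **`t_{π ⊗ |det|^s, v} = q_v^{-s} t_{π, v}`** (same level; `|det t_{v,i}|_𝔸 = q_v^{-i}`).
* `mulChar_detTwist_apply_posRealScalar_mul` — on `A_G`, `|det (a g)|^s = a^{n[K:ℚ]s} |det g|^s`.

## References

* A. Borel, H. Jacquet, *Automorphic forms and automorphic representations*, Proc. Sympos. Pure
  Math. 33 (1979), part 1, §4.2–4.6, 5.7 [BorelJacquetCorvallis1979].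
* J. Arthur, L. Clozel, *Simple algebras, base change, and the advanced theory of the trace
  formula* (1989), Ch. 3, proof of Thm. 3.1 [ArthurClozelAMS120].
-/

noncomputable section

open scoped MatrixGroups NNReal Classical
open NumberField NumberField.mixedEmbedding IsDedekindDomain NormedSpace

namespace Literature.NumberTheory.Automorphic

open Literature.NumberTheory.GaloisRepresentations (HeckeCharacter ideleGroup localUnits)

variable {n : ℕ} {K : Type} [Field K] [NumberField K] {hcpt : isCompact_glFiniteIntegralLevel n K}

/-! ### The characters `|det|_𝔸^s` of `GL_n(𝔸_K)` -/

/-- `||det g|_𝔸^s| = |det g|_𝔸^{re s}`. [folklore] -/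
theorem norm_detTwist_of_cpow {χ : HeckeCharacter K} {s : ℂ}
    (hχ : ∀ x : ideleGroup K, ((χ x : ℂˣ) : ℂ) = (GaloisRepresentations.ideleNorm x : ℂ) ^ s)
    (g : GL (Fin n) (AdeleRing (𝓞 K) K)) :
    ‖(detTwist n χ g : ℂ)‖ = GaloisRepresentations.ideleNorm (Matrix.GeneralLinearGroup.det g) ^ s.re := by
  rw [detTwist_apply, hχ, Complex.norm_cpow_eq_rpow_re_of_pos]
  rw [← coe_ideleNorm]
  exact NNReal.coe_pos.2 (pos_iff_ne_zero.2 (ideleNorm_ne_zero _))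

/-- The inverse of `‖·‖^s` is `‖·‖^{-s}`. [folklore] -/
theorem inv_apply_of_cpow {χ : HeckeCharacter K} {s : ℂ}
    (hχ : ∀ x : ideleGroup K, ((χ x : ℂˣ) : ℂ) = (GaloisRepresentations.ideleNorm x : ℂ) ^ s)
    (x : ideleGroup K) : ((χ⁻¹ x : ℂˣ) : ℂ) = (GaloisRepresentations.ideleNorm x : ℂ) ^ (-s) := by
  rw [GaloisRepresentations.HeckeCharacter.inv_apply, Units.val_inv_eq_inv_val, hχ, Complex.cpow_neg]

/-- `|det|_𝔸^s` is trivial on every level of `GL_n` and in particular on the principal congruence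
subgroups `K(𝔫)` (which lie in the integral level `{1} × GL_n(𝒪̂_K)`, compact by `hcpt`). [folklore] -/
theorem detTwist_eq_one_of_mem_principalCongruenceLevel (hcpt : isCompact_glFiniteIntegralLevel n K)
    {χ : HeckeCharacter K} {s : ℂ}
    (hχ : ∀ x : ideleGroup K, ((χ x : ℂˣ) : ℂ) = (GaloisRepresentations.ideleNorm x : ℂ) ^ s)
    (𝔫 : Ideal (𝓞 K)) {k : GL (Fin n) (AdeleRing (𝓞 K) K)} (hk : k ∈ principalCongruenceLevel n K 𝔫) :
    detTwist n χ k = 1 :=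
  apply_det_eq_one_of_mem_finiteLevelsGL hχ (glIntegralLevel_mem_finiteLevelsGL n K hcpt)
    (principalCongruenceLevel_le n K 𝔫 hk)

/-- **`|det|_𝔸^s` on `A_G`**: `|det (a g)|_𝔸^s = (a^{n[K:ℚ]})^s |det g|_𝔸^s` for `a ∈ ℝ_{>0}`
(`ideleNorm_det_posRealScalar`). [folklore] -/
theorem detTwist_posRealScalar_of_cpow {χ : HeckeCharacter K} {s : ℂ}
    (hχ : ∀ x : ideleGroup K, ((χ x : ℂˣ) : ℂ) = (GaloisRepresentations.ideleNorm x : ℂ) ^ s)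
    (t : ℝ≥0ˣ) :
    ((detTwist n χ (posRealScalar n K t) : ℂˣ) : ℂ) =
      ((((t : ℝ≥0) : ℝ) ^ (n * Module.finrank ℚ K) : ℝ) : ℂ) ^ s := by
  rw [detTwist_apply, hχ, ← coe_ideleNorm, ideleNorm_det_posRealScalar, NNReal.coe_pow]

/-- **`|det (exp X, 1)|_𝔸^s = e^{s λ(X)}`** on the one-parameter subgroups of `𝔤 = 𝔤𝔩_n(K_∞)`, for a
real linear form `λ` on `𝔤` killing brackets (`exists_linearMap_ideleNorm_det_ofInfinite_expGL`):
the hypothesis of `ArchimedeanCharacterTwist` for all the characters `‖·‖^s ∘ det` at once.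
Borel–Jacquet 1979, 5.7. [cite: BorelJacquetCorvallis1979, 5.7] -/
theorem exists_linearMap_detTwist_ofArch_expMem (hcpt : isCompact_glFiniteIntegralLevel n K) :
    ∃ lam : (AutomorphyDatum.gl n K hcpt).arch.lie →ₗ[ℝ] ℝ,
      (∀ X Y : (AutomorphyDatum.gl n K hcpt).arch.lie, lam ⁅X, Y⁆ = 0) ∧
      ∀ (χ : HeckeCharacter K) (s : ℂ),
        (∀ x : ideleGroup K, ((χ x : ℂˣ) : ℂ) = (GaloisRepresentations.ideleNorm x : ℂ) ^ s) →
        ∀ X : (AutomorphyDatum.gl n K hcpt).arch.lie,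
          ((detTwist n χ ((AutomorphyDatum.gl n K hcpt).ofArch
            ((AutomorphyDatum.gl n K hcpt).arch.expMem X)) : ℂˣ) : ℂ) = Complex.exp (s * (lam X : ℂ)) := by
  -- Mathlib idiom (Mathlib/Algebra/Lie/OfAssociative.lean): the commutator Lie ring on matrices
  letI : LieRing (Matrix (Fin n) (Fin n) (mixedSpace K)) := LieRing.ofAssociativeRing
  obtain ⟨lam₀, hbr, hlam₀⟩ := exists_linearMap_ideleNorm_det_ofInfinite_expGL n K
  refine ⟨lam₀.comp (AutomorphyDatum.gl n K hcpt).arch.lie.toSubmodule.subtype, fun X Y => ?_,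
    fun χ s hχ X => ?_⟩
  · rw [LinearMap.comp_apply, Submodule.subtype_apply]
    change lam₀ ((⁅X, Y⁆ : (AutomorphyDatum.gl n K hcpt).arch.lie) : Matrix (Fin n) (Fin n) (mixedSpace K)) = 0
    rw [LieSubalgebra.coe_bracket, LieRing.of_associative_ring_bracket]
    exact hbr _ _
  · rw [detTwist_apply, hχ, AutomorphyDatum.gl_ofArch_apply, RealMatrixGroup.coe_expMem, hlam₀,
      Complex.ofReal_exp, Complex.cpow_def_of_ne_zero (Complex.exp_ne_zero _),
      Complex.log_exp (by rw [Complex.ofReal_im]; exact neg_lt_zero.2 Real.pi_pos)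
        (by rw [Complex.ofReal_im]; exact Real.pi_pos.le), mul_comm]
    rfl

/-! ### `|det|^s · φ` is an automorphic form -/

/-- **Twists of automorphic forms by `|det|_𝔸^s` are automorphic forms** (`n ≥ 1`): conditions
(a)–(d) of Borel–Jacquet 1979, §4.2 for `(|det|^s) · φ` — left `GL_n(K)`-invariance (product
formula), the same level (`|det|_𝔸 = 1` on compact subgroups of `GL_n(𝔸_K^∞)`), smoothness and
`Z(𝔤)`-finiteness (`ArchimedeanCharacterTwist.isZFinite_mulChar_of_exp_family`, the differential of
`|det|^s` along `𝔤` being `s λ`), `K_∞`-finiteness, and moderate growth (`|det g|_𝔸^{re s}` is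
polynomially bounded by the height, `exists_ideleNorm_det_rpow_le_height`).
Borel–Jacquet 1979, §4.2 and 5.7. [cite: BorelJacquetCorvallis1979, §4.2] -/
theorem IsAutomorphicForm.mulChar_detTwist_of_cpow [NeZero n] {χ : HeckeCharacter K} {s : ℂ}
    (hχ : ∀ x : ideleGroup K, ((χ x : ℂˣ) : ℂ) = (GaloisRepresentations.ideleNorm x : ℂ) ^ s)
    {φ : (AdelicGroupData.gl n K).Adelic → ℂ} (hφ : IsAutomorphicForm (AutomorphyDatum.gl n K hcpt) φ) :
    IsAutomorphicForm (AutomorphyDatum.gl n K hcpt) (mulChar (detTwist n χ) φ) := by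
  -- the family `|det|^{s'}`, `s' ∈ ℂ`, with the given character at `s`
  obtain ⟨lam, hlam, hfam⟩ := exists_linearMap_detTwist_ofArch_expMem hcpt
  have hex := exists_heckeCharacter_ideleNorm_cpow K
  choose χf hχf using hex
  set c : ℂ → ((AdelicGroupData.gl n K).Adelic →* ℂˣ) :=
    Function.update (fun s' => detTwist n (χf s')) s (detTwist n χ) with hc
  have hcs : c s = detTwist n χ := by rw [hc, Function.update_self]
  have hc' : ∀ (s' : ℂ) (X : (AutomorphyDatum.gl n K hcpt).arch.lie),
      (c s' ((AutomorphyDatum.gl n K hcpt).ofArch ((AutomorphyDatum.gl n K hcpt).arch.expMem X)) : ℂ) =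
        Complex.exp (s' * (lam X : ℂ)) := by
    intro s' X
    by_cases h : s' = s
    · subst h; rw [hcs]; exact hfam χ s' hχ X
    · rw [hc, Function.update_of_ne h]; exact hfam (χf s') s' (hχf s') X
  haveI : FiniteDimensional ℝ (mixedSpace K) := inferInstance
  refine ⟨?_, ?_, ?_, ?_, ?_, ?_⟩
  · intro γ hγ g
    rw [mulChar_apply, mulChar_apply, map_mul, detTwist_eq_one_of_mem_arithmeticSubgroup n χ hγ,
      one_mul, hφ.leftInvariant γ hγ g]
  · obtain ⟨U, hU, hUφ⟩ := hφ.exists_level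
    refine ⟨U, hU, fun u hu g => ?_⟩
    rw [mulChar_apply, mulChar_apply, map_mul, hUφ u hu g]
    have : detTwist n χ u = 1 := apply_det_eq_one_of_mem_finiteLevelsGL hχ hU hu
    rw [this, mul_one]
  · rw [← hcs]
    exact isArchSmooth_mulChar_of_exp_family _ hc' s hφ.archSmooth
  · exact isKFinite_mulChar _ hφ.kFinite
  · rw [← hcs]
    exact isZFinite_mulChar_of_exp_family _ hlam hc' s hφ.archSmooth hφ.zFinite
  · obtain ⟨C, r, hC⟩ := hφ.moderateGrowth
    obtain ⟨C', r', -, hC'⟩ := exists_ideleNorm_det_rpow_le_height (n := n) (K := K) s.re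
    refine ⟨C' * C, r' + r, fun g => ?_⟩
    have h1 := hC' g
    have h2 := hC g
    rw [AutomorphyDatum.gl_height] at h2 ⊢
    have hN : 0 ≤ GaloisRepresentations.ideleNorm (Matrix.GeneralLinearGroup.det g) := by
      rw [← coe_ideleNorm]; exact NNReal.coe_nonneg _
    rw [mulChar_apply, norm_mul, norm_detTwist_of_cpow hχ, pow_add, mul_mul_mul_comm]
    exact mul_le_mul h1 h2 (norm_nonneg _) ((Real.rpow_nonneg hN _).trans h1)

/-- The twist `|det|^s · W` of a space `W` of automorphic forms consists of automorphic forms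
(`n ≥ 1`). Borel–Jacquet 1979, §4.2–4.3. [cite: BorelJacquetCorvallis1979, §4.3] -/
theorem map_mulChar_detTwist_le_automorphicForms_of_cpow [NeZero n] {χ : HeckeCharacter K} {s : ℂ}
    (hχ : ∀ x : ideleGroup K, ((χ x : ℂˣ) : ℂ) = (GaloisRepresentations.ideleNorm x : ℂ) ^ s)
    {W : Submodule ℂ ((AdelicGroupData.gl n K).Adelic → ℂ)}
    (hW : W ≤ automorphicForms (AutomorphyDatum.gl n K hcpt)) :
    W.map (mulChar (detTwist n χ)) ≤ automorphicForms (AutomorphyDatum.gl n K hcpt) := by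
  refine (Submodule.map_mono hW).trans ?_
  rw [automorphicForms, Submodule.map_span, Submodule.span_le]
  rintro _ ⟨φ, hφ, rfl⟩
  exact Submodule.subset_span (IsAutomorphicForm.mulChar_detTwist_of_cpow hχ hφ)

/-- **Twists of stable subspaces by `|det|^s` are stable** (`(𝔤, K_∞) × GL_n(𝔸_K^∞)`-submodules of
`𝒜`; `n ≥ 1`): `r(h) (c · φ) = c(h) · (c · r(h) φ)` and `X (c · φ) = c · (X φ + s λ(X) φ)`
(`lieDeriv_mulChar_of_exp`). Borel–Jacquet 1979, §4.3, §4.6 and 5.7. [cite: BorelJacquetCorvallis1979, §4.6] -/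
theorem IsStableSubmodule.map_mulChar_detTwist_of_cpow [NeZero n] {χ : HeckeCharacter K} {s : ℂ}
    (hχ : ∀ x : ideleGroup K, ((χ x : ℂˣ) : ℂ) = (GaloisRepresentations.ideleNorm x : ℂ) ^ s)
    {W : Submodule ℂ ((AdelicGroupData.gl n K).Adelic → ℂ)}
    (hW : IsStableSubmodule (AutomorphyDatum.gl n K hcpt) W) :
    IsStableSubmodule (AutomorphyDatum.gl n K hcpt) (W.map (mulChar (detTwist n χ))) where
  le_automorphicForms := map_mulChar_detTwist_le_automorphicForms_of_cpow hχ hW.le_automorphicForms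
  finite_stable h hh := by
    rintro _ ⟨φ, hφ, rfl⟩
    rw [Submodule.mem_comap, rightTranslation_mulChar]
    exact Submodule.smul_mem _ _ (Submodule.mem_map_of_mem (hW.finite_stable h hh hφ))
  k_stable k := by
    rintro _ ⟨φ, hφ, rfl⟩
    rw [Submodule.mem_comap, rightTranslation_mulChar]
    exact Submodule.smul_mem _ _ (Submodule.mem_map_of_mem (hW.k_stable k hφ))
  lie_stable X := by
    rintro _ ⟨φ, hφ, rfl⟩
    obtain ⟨lam, -, hfam⟩ := exists_linearMap_detTwist_ofArch_expMem hcpt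
    haveI : FiniteDimensional ℝ (mixedSpace K) := inferInstance
    have hc : ∀ X : (AutomorphyDatum.gl n K hcpt).arch.lie,
        ((detTwist n χ ((AutomorphyDatum.gl n K hcpt).ofArch ((AutomorphyDatum.gl n K hcpt).arch.expMem X)) :
          ℂˣ) : ℂ) = Complex.exp ((s • (Complex.ofRealAm.toLinearMap.comp lam)) X) := fun X => by
      rw [hfam χ s hχ X]; rfl
    rw [lieDeriv_mulChar_of_exp _ hc X (hW.isArchSmooth hφ), map_add, map_smul]
    exact Submodule.add_mem _ (Submodule.mem_map_of_mem (hW.lie_stable X φ hφ))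
      (Submodule.smul_mem _ _ (Submodule.mem_map_of_mem hφ))

/-- **The twist `π ⊗ |det|_𝔸^s` of an automorphic representation of `GL_n(𝔸_K)` in the sense of
Borel–Jacquet** (`n ≥ 1`): there is a datum `π' = W · c / W' · c`, `c = ‖·‖^s ∘ det`
(irreducibility is transported along `W'' ↦ W'' · c⁻¹`, `c⁻¹ = ‖·‖^{-s} ∘ det`). Packaged
existentially (no definition). Borel–Jacquet 1979, §4.6 and 5.7. [cite: BorelJacquetCorvallis1979, 5.7] -/
theorem exists_automorphicRepData_map_mulChar_detTwist [NeZero n] {χ : HeckeCharacter K} {s : ℂ}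
    (hχ : ∀ x : ideleGroup K, ((χ x : ℂˣ) : ℂ) = (GaloisRepresentations.ideleNorm x : ℂ) ^ s)
    (π : AutomorphicRepData (AutomorphyDatum.gl n K hcpt)) :
    ∃ π' : AutomorphicRepData (AutomorphyDatum.gl n K hcpt),
      π'.W = π.W.map (mulChar (detTwist n χ)) ∧ π'.W' = π.W'.map (mulChar (detTwist n χ)) := by
  have hχ' := inv_apply_of_cpow hχ
  refine ⟨{ W := π.W.map (mulChar (detTwist n χ))
            W' := π.W'.map (mulChar (detTwist n χ))
            lt := Submodule.map_strictMono_of_injective (mulChar_injective _) π.lt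
            stable := π.stable.map_mulChar_detTwist_of_cpow hχ
            stable' := π.stable'.map_mulChar_detTwist_of_cpow hχ
            irreducible := fun W'' h₁ h₂ hst => ?_ }, rfl, rfl⟩
  have hst' := hst.map_mulChar_detTwist_of_cpow hχ'
  rw [detTwist_inv] at hst'
  have h₁' : π.W' ≤ W''.map (mulChar (detTwist n χ)⁻¹) := by
    rw [← map_mulChar_inv_map_mulChar (detTwist n χ) π.W']
    exact Submodule.map_mono h₁
  have h₂' : W''.map (mulChar (detTwist n χ)⁻¹) ≤ π.W := by
    rw [← map_mulChar_inv_map_mulChar (detTwist n χ) π.W]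
    exact Submodule.map_mono h₂
  rcases π.irreducible _ h₁' h₂' hst' with h | h
  · left
    rw [← map_mulChar_map_mulChar_inv (detTwist n χ) W'', h]
  · right
    rw [← map_mulChar_map_mulChar_inv (detTwist n χ) W'', h]

/-- **Twists of cusp forms by `|det|^s` are cusp forms** (`|det|` is trivial on the unipotent
radicals, `CuspConditionGL.mulChar_detTwist`). Borel–Jacquet 1979, 4.4. [cite: BorelJacquetCorvallis1979, 4.4] -/
theorem IsCuspFormGL.mulChar_detTwist_of_cpow [NeZero n] {χ : HeckeCharacter K} {s : ℂ}
    (hχ : ∀ x : ideleGroup K, ((χ x : ℂˣ) : ℂ) = (GaloisRepresentations.ideleNorm x : ℂ) ^ s)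
    {φ : (AdelicGroupData.gl n K).Adelic → ℂ} (hφ : IsCuspFormGL n K hcpt φ) :
    IsCuspFormGL n K hcpt (mulChar (detTwist n χ) φ) :=
  ⟨hφ.1.mulChar_detTwist_of_cpow hχ, fun k hk hkn => (hφ.2 k hk hkn).mulChar_detTwist χ⟩

/-- The twist by `|det|^s` of a space of cusp forms consists of cusp forms. Borel–Jacquet 1979,
4.4–4.6. [cite: BorelJacquetCorvallis1979, 4.6] -/
theorem map_mulChar_detTwist_le_cuspFormsGL_of_cpow [NeZero n] {χ : HeckeCharacter K} {s : ℂ}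
    (hχ : ∀ x : ideleGroup K, ((χ x : ℂˣ) : ℂ) = (GaloisRepresentations.ideleNorm x : ℂ) ^ s)
    {W : Submodule ℂ ((AdelicGroupData.gl n K).Adelic → ℂ)} (hW : W ≤ cuspFormsGL n K hcpt) :
    W.map (mulChar (detTwist n χ)) ≤ cuspFormsGL n K hcpt := by
  refine (Submodule.map_mono hW).trans ?_
  rw [cuspFormsGL, Submodule.map_span, Submodule.span_le]
  rintro _ ⟨φ, hφ, rfl⟩
  exact Submodule.subset_span (IsCuspFormGL.mulChar_detTwist_of_cpow hχ hφ)

/-- **The twist `π ⊗ |det|_𝔸^s` of a cuspidal automorphic representation of `GL_n(𝔸_K)`** is a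
cuspidal automorphic representation (Borel–Jacquet datum; packaged existentially).
Borel–Jacquet 1979, 5.7. [cite: BorelJacquetCorvallis1979, 5.7] -/
theorem exists_cuspidalAutomorphicRepData_map_mulChar_detTwist [NeZero n] {χ : HeckeCharacter K}
    {s : ℂ} (hχ : ∀ x : ideleGroup K, ((χ x : ℂˣ) : ℂ) = (GaloisRepresentations.ideleNorm x : ℂ) ^ s)
    (π : CuspidalAutomorphicRepData n K hcpt) :
    ∃ π' : CuspidalAutomorphicRepData n K hcpt,
      π'.1.W = π.1.W.map (mulChar (detTwist n χ)) ∧ π'.1.W' = π.1.W'.map (mulChar (detTwist n χ)) := by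
  obtain ⟨π', hW, hW'⟩ := exists_automorphicRepData_map_mulChar_detTwist hχ π.1
  exact ⟨⟨π', hW ▸ map_mulChar_detTwist_le_cuspFormsGL_of_cpow hχ π.2⟩, hW, hW'⟩

/-! ### Satake parameters: `t_{π ⊗ |det|^s, v} = q_v^{-s} t_{π, v}` -/

/-- `|det t_{v,i}|_𝔸^s = (q_v^{-s})^i`. [folklore] -/
theorem detTwist_heckeDiagAt_of_cpow {χ : HeckeCharacter K} {s : ℂ}
    (hχ : ∀ x : ideleGroup K, ((χ x : ℂˣ) : ℂ) = (GaloisRepresentations.ideleNorm x : ℂ) ^ s)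
    {v : HeightOneSpectrum (𝓞 K)} {ϖ : (v.adicCompletion K)ˣ}
    (hϖ : Valued.v (ϖ : v.adicCompletion K) = WithZero.exp (-1 : ℤ)) {i : ℕ} (hi : i ≤ n) :
    ((detTwist n χ (heckeDiagAt n K v ϖ i) : ℂˣ) : ℂ) = ((v.residueCard : ℂ) ^ (-s)) ^ i := by
  have hq : (0 : ℝ) < (v.residueCard : ℝ) := by exact_mod_cast Nat.zero_lt_of_lt v.one_lt_residueCard
  rw [detTwist_apply, hχ, ideleNorm_det_heckeDiagAt hϖ hi, ← Real.rpow_natCast,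
    ← Complex.cpow_mul_ofReal_nonneg (inv_nonneg.2 hq.le), mul_comm, Complex.ofReal_natCast,
    Complex.cpow_mul_nat, Complex.ofReal_inv, Complex.ofReal_natCast, Complex.inv_cpow _ _ (by
      rw [Complex.natCast_arg]; exact Real.pi_ne_zero.symm), ← Complex.cpow_neg]

/-- **Satake parameters of `π ⊗ |det|_𝔸^s`: `t_{π ⊗ |det|^s, v} = q_v^{-s} t_{π,v}`.** If `π` and
`π'` are Borel–Jacquet data with `W_{π'} = |det|^s · W_π`, `W'_{π'} = |det|^s · W'_π` and `π` has Satake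
parameter `α` at `v`, then `π'` has Satake parameter `q_v^{-s} · α` at `v` — at the same level
`K(𝔫)` (on which `|det|^s` is trivial, `detTwist_eq_one_of_mem_principalCongruenceLevel`) and the same
uniformizer: `[K t_{v,i} K] (c · φ) = c(t_{v,i}) · c · [K t_{v,i} K] φ`
(`heckeOperator_apply_semilinear`) with `c(t_{v,i}) = |ϖ_v^i|^s = (q_v^{-s})^i`, and
`e_i(z α) = zⁱ e_i(α)`. Borel–Jacquet 1979, 5.7; Arthur–Clozel 1989, Ch. 3, proof of Thm. 3.1 (the
computation "`t_{π ⊗ η, v} = η(ϖ_v) t_{π,v}`" for `η = |·|^s`). [cite: ArthurClozelAMS120, Ch. 3, proof of Thm. 3.1] -/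
theorem AutomorphicRepData.HasSatakeParamAt.of_map_mulChar_detTwist_of_cpow {χ : HeckeCharacter K}
    {s : ℂ} (hχ : ∀ x : ideleGroup K, ((χ x : ℂˣ) : ℂ) = (GaloisRepresentations.ideleNorm x : ℂ) ^ s)
    {π π' : AutomorphicRepData (AutomorphyDatum.gl n K hcpt)}
    (hW : π'.W = π.W.map (mulChar (detTwist n χ))) (hW' : π'.W' = π.W'.map (mulChar (detTwist n χ)))
    {v : HeightOneSpectrum (𝓞 K)} {α : Multiset ℂ} (h : π.HasSatakeParamAt v α) :
    π'.HasSatakeParamAt v (α.map (((v.residueCard : ℂ) ^ (-s)) * ·)) := by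
  obtain ⟨𝔫, ϖ, h𝔫, hv𝔫, hϖ, hcard, φ, hφW, hφW', hfix, hT⟩ := h
  set c := detTwist n χ with hc
  set z : ℂ := (v.residueCard : ℂ) ^ (-s) with hz
  have hcU : ∀ u ∈ principalCongruenceLevel n K 𝔫, c u = 1 := fun u hu =>
    detTwist_eq_one_of_mem_principalCongruenceLevel hcpt hχ 𝔫 hu
  refine ⟨𝔫, ϖ, h𝔫, hv𝔫, hϖ, by rw [Multiset.card_map, hcard], mulChar c φ, ?_, ?_, fun u hu => ?_,
    fun i hi => ?_⟩
  · rw [hW]; exact Submodule.mem_map_of_mem hφW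
  · rw [hW']; exact fun hmem => hφW' ((mulChar_mem_map_mulChar_iff _ _ _).mp hmem)
  · rw [rightTranslation_mulChar, hfix u hu, hcU u hu, Units.val_one, one_smul]
  · have htw : heckeOperator (rightTranslation (AdelicGroupData.gl n K))
        (principalCongruenceLevel n K 𝔫) (heckeDiagAt n K v ϖ i) (mulChar c φ) =
        (c (heckeDiagAt n K v ϖ i) : ℂ) • mulChar c (heckeOperator (rightTranslation (AdelicGroupData.gl n K))
          (principalCongruenceLevel n K 𝔫) (heckeDiagAt n K v ϖ i) φ) :=
      heckeOperator_apply_semilinear _ _ (mulChar c) (fun x => (c x : ℂ))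
        (fun x ψ => rightTranslation_mulChar _ c x ψ) _
        (fun y hy => by rw [apply_out_eq_of_mem_orbit c _ hcU _ hy]) φ
    have hct : (c (heckeDiagAt n K v ϖ i) : ℂ) = z ^ i := detTwist_heckeDiagAt_of_cpow hχ hϖ hi
    rw [hW', htw, hct, esymm_map_const_mul]
    have key : z ^ i • mulChar c (heckeOperator (rightTranslation (AdelicGroupData.gl n K))
          (principalCongruenceLevel n K 𝔫) (heckeDiagAt n K v ϖ i) φ) -
        ((((Real.sqrt (v.residueCard : ℝ)) : ℝ) : ℂ) ^ (i * (n - i)) * (z ^ i * α.esymm i)) •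
          mulChar c φ =
        mulChar c (z ^ i • (heckeOperator (rightTranslation (AdelicGroupData.gl n K))
          (principalCongruenceLevel n K 𝔫) (heckeDiagAt n K v ϖ i) φ -
            ((((Real.sqrt (v.residueCard : ℝ)) : ℝ) : ℂ) ^ (i * (n - i)) * α.esymm i) • φ)) := by
      rw [map_smul, map_sub, map_smul, smul_sub, smul_smul, mul_left_comm]
    rw [key]
    exact Submodule.mem_map_of_mem (Submodule.smul_mem _ _ (hT i hi))

/-! ### `|det|^s · φ` on the split component `A_G` -/

/-- **`(|det|^s · φ)(a g) = (a^{n[K:ℚ]})^s (|det|^s · φ)(g)`-type identity on `A_G`**: if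
`φ (a g) = a^μ φ (g)` for `a ∈ A_G` then `(c · φ)(a g) = (a^{n[K:ℚ]})^s a^μ (c · φ)(g)` for
`c = ‖·‖^s ∘ det`; with `s = -μ / (n [K:ℚ])` the twisted form is `A_G`-invariant
(`((a^{nd})^{s} a^{μ} = 1`). Borel–Jacquet 1979, 5.7. [cite: BorelJacquetCorvallis1979, 5.7] -/
theorem mulChar_detTwist_apply_posRealScalar_mul_of_cpow {χ : HeckeCharacter K} {s : ℂ}
    (hχ : ∀ x : ideleGroup K, ((χ x : ℂˣ) : ℂ) = (GaloisRepresentations.ideleNorm x : ℂ) ^ s)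
    {μ : ℂ} (hs : s * (n * Module.finrank ℚ K : ℕ) = -μ)
    {φ : (AdelicGroupData.gl n K).Adelic → ℂ}
    (hφ : ∀ (t : ℝ≥0ˣ) (g : (AdelicGroupData.gl n K).Adelic),
      φ ((show (AdelicGroupData.gl n K).Adelic from posRealScalar n K t) * g) = (((t : ℝ≥0) : ℝ) : ℂ) ^ μ * φ g)
    (t : ℝ≥0ˣ) (g : (AdelicGroupData.gl n K).Adelic) :
    mulChar (detTwist n χ) φ ((show (AdelicGroupData.gl n K).Adelic from posRealScalar n K t) * g) =
      mulChar (detTwist n χ) φ g := by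
  have ht : (0 : ℝ) < ((t : ℝ≥0) : ℝ) := NNReal.coe_pos.2 (pos_iff_ne_zero.2 t.ne_zero)
  have ht' : (((t : ℝ≥0) : ℝ) : ℂ) ≠ 0 := Complex.ofReal_ne_zero.2 ht.ne'
  rw [mulChar_apply, mulChar_apply, map_mul, Units.val_mul, hφ t g]
  change ((detTwist n χ (posRealScalar n K t) : ℂˣ) : ℂ) * _ * _ = _
  rw [detTwist_posRealScalar_of_cpow hχ, ← Real.rpow_natCast, ← Complex.cpow_mul_ofReal_nonneg ht.le]
  have hexp : (((n * Module.finrank ℚ K : ℕ) : ℝ) : ℂ) * s = -μ := by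
    rw [mul_comm, Complex.ofReal_natCast]; exact hs
  rw [hexp, Complex.cpow_neg]
  -- `t^{-μ} c(g) t^{μ} φ g = c(g) φ g`
  have hne : ((((t : ℝ≥0) : ℝ) : ℂ)) ^ μ ≠ 0 := fun h => ht' (Complex.cpow_eq_zero_iff _ _ |>.1 h).1
  calc ((((t : ℝ≥0) : ℝ) : ℂ) ^ μ)⁻¹ * ((detTwist n χ g : ℂˣ) : ℂ) * ((((t : ℝ≥0) : ℝ) : ℂ) ^ μ * φ g)
      = ((detTwist n χ g : ℂˣ) : ℂ) * φ g * (((((t : ℝ≥0) : ℝ) : ℂ) ^ μ)⁻¹ * (((t : ℝ≥0) : ℝ) : ℂ) ^ μ) := by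
        ring
    _ = ((detTwist n χ g : ℂˣ) : ℂ) * φ g := by rw [inv_mul_cancel₀ hne, mul_one]

end Literature.NumberTheory.Automorphic
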